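import Summits.BirchSwinnertonDyer.BirchSwinnertonDyer.Theorems.SignedLowerHalvesSmallImageLowerHalfBothSignsRttD2SpecialisationHKCyclic
import Summits.BirchSwinnertonDyer.BirchSwinnertonDyer.Theorems.SignedLowerHalvesSmallImageLowerHalfBothSignsRttCharRoadE2GlueAlgebra
import Summits.BirchSwinnertonDyer.Rank1Residual.X2.DualRestrictionInvariants
import Literature.NumberTheory.EllipticCurves.IwasawaAlgebraProofs
import Mathlib.RingTheory.PowerSeries.Ideal
import HarnessLib

/-!
# Route `SignedLowerHalves`, crux L `SmallImageLowerHalfBothSigns` (stmt-BirchSwinnertonDyer-23599), line `rtt_w3` v13 — E2, row (6′d), LEAD: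
# ROAD D IN EQUALITY FORM — `λ((H¹⧸Z)/f) + λ(H²[f]) = λ(H²/f) + λ((H¹⧸Z)[f])` from JLK's `Thm52Shape` specialised along `φ_b`

WHY (BRIEF-E2 rev 3.2 §2 step 3, `Lines/rtt_w3-BRIEF-E2-g9c.md`). The E2-K junction (row (6′)) is index bookkeeping: the glue's
`hK : λ(ker gX ⧸ Λ_𝒪∙z) ≤ λ(coker gX)` follows from the index identity (p777767), the index of `j ∘ sp¹` (p777820) and road D's inequality
WITH the term `λ(H²₂[f])` kept — `λ(Hsp ⧸ ∙ζ̄) + λ(H²₂[f]) = λ(Ysp)` — because `coker sp¹ ↪ H²₂[f]` is exactly road D's slack. -w3 g19's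
`SmallImageRttD2LamSpec.lambdaInvariant_quotSMulTop_le_of_thm52Shape` (p776332) drops that term; this file proves the four-term EQUALITY
(`lambdaInvariant_quotSMulTop_add_torsionBy_eq_of_thm52Shape`) and its defect-free form (`…_of_torsionBy_eq_bot`), by reading p776030's
`char((H¹⧸Z)/f)·char(H²[f]) = char(H²/f)·char((H¹⧸Z)[f])` in `λ` through a two-sided version of the (K)-socket:
* `lambdaInvariant_add_eq_of_charIdeal_mul_eq_of_algebraMap_eq` / `…_add_eq_add_…` — `char M · char M' = char N (· char N') ⟹ λ M + λ M' = λ N (+ λ N')`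
  for f.g. torsion `Λ_𝒪`-modules in the glue's context (`char` multiplicative on `M × M'`, the (K)-socket of `…RttE2KLambdaSocketGlue`, `λ` additive over `Λ`);
* `isTorsion_of_isTorsion_iwasawaAlgebraO`, `moduleFinite_of_moduleFinite_iwasawaAlgebraO` — f.g. torsion over `Λ_𝒪` ⟹ f.g. torsion over `Λ`
  (`Λ_𝒪` finite, hence integral, over `Λ`); `isTorsion_prod_of_isTorsion`; `lambdaInvariant_eq_zero_of_subsingleton`.
THEOREMS ONLY (kernel commutative algebra; `--supports stmt-BirchSwinnertonDyer-23599` helper); closes nothing; crux L, crux M, E2 and BSD remain OPEN and are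
proved for NO curve by any of this. [cite: JohnsonLeungKings2011, Thm. 5.2, Cor. 5.3, Lemma 4.4] [cite: Washington1997, §13.2] [cite: BourbakiAC5to7, VII §4.5 Prop. 10]
-/

set_option autoImplicit false
-- the Theorems namespace of this sub repeats the summit name by design (D-0017 nested layout)
set_option linter.dupNamespace false

noncomputable section

open scoped Pointwise TensorProduct

open PowerSeries Literature.NumberTheory.Automorphic Literature.NumberTheory.EllipticCurves Literature.NumberTheory.EllipticCurves.Module
open Literature.NumberTheory.ComplexMultiplication.EllipticUnits.JohnsonLeungKings2011
open Summit.BirchSwinnertonDyer.BirchSwinnertonDyer.Theorems.SignedBaseChangeAcDivSpecialization.LocalLength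
  (isPrincipal_charIdeal_of_ufm)

namespace Summit.BirchSwinnertonDyer.BirchSwinnertonDyer.Theorems.SmallImageRttD2LamSpec

universe u v w

/-- **A product of torsion modules is torsion** (commutative ring, `Module.IsTorsion`). [folklore] -/
theorem isTorsion_prod_of_isTorsion {R : Type u} [CommRing R] {M : Type v} {M' : Type w} [AddCommGroup M] [Module R M]
    [AddCommGroup M'] [Module R M'] (hM : Module.IsTorsion R M) (hM' : Module.IsTorsion R M') :
    Module.IsTorsion R (M × M') := by
  rintro ⟨x, y⟩
  obtain ⟨a, ha⟩ := @hM x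
  obtain ⟨b, hb⟩ := @hM' y
  refine ⟨a * b, Prod.ext ?_ ?_⟩
  · change ((a : R) * (b : R)) • x = 0
    rw [mul_comm, mul_smul, show (a : R) • x = 0 from ha, smul_zero]
  · change ((a : R) * (b : R)) • y = 0
    rw [mul_smul, show (b : R) • y = 0 from hb, smul_zero]

section LambdaO

variable (p : ℕ) [Fact p.Prime] (S : Set (PadicAlgCl p)) [FiniteDimensional ℚ_[p] (padicCoeffField S)]
  [Algebra (IwasawaAlgebra p) (IwasawaAlgebraO S)]
  (halg : ∀ r : IwasawaAlgebra p, algebraMap (IwasawaAlgebra p) (IwasawaAlgebraO S) r = iwasawaToIwasawaO S r)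

include halg in
/-- **`Λ_𝒪`-torsion ⟹ `Λ`-torsion** (glue context: `[Algebra Λ Λ_𝒪]` with structure map `iwasawaToIwasawaO S`, scalar tower on `M`):
`Λ_𝒪 = 𝒪⟦T⟧` is finite, hence integral, over `Λ = ℤ_p⟦T⟧`, so a non-zero annihilator `a ∈ Λ_𝒪` of `x` has a non-zero `Λ`-multiple
(the constant term of an integral equation), which kills `x`. [cite: Washington1997, §13.2] [folklore] -/
theorem isTorsion_of_isTorsion_iwasawaAlgebraO (M : Type v) [AddCommGroup M] [Module (IwasawaAlgebraO S) M]
    [Module (IwasawaAlgebra p) M] [IsScalarTower (IwasawaAlgebra p) (IwasawaAlgebraO S) M]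
    (hM : Module.IsTorsion (IwasawaAlgebraO S) M) : Module.IsTorsion (IwasawaAlgebra p) M := by
  haveI := SmallImageRttCharRoad.moduleFinite_iwasawaAlgebraO S halg
  intro x
  obtain ⟨⟨a, ha⟩, hax⟩ := @hM x
  have ha0 : (a : IwasawaAlgebraO S) ≠ 0 := nonZeroDivisors.ne_zero ha
  have hint : IsIntegral (IwasawaAlgebra p) a := IsIntegral.of_finite (IwasawaAlgebra p) a
  have hne : (Ideal.span {a}).comap (algebraMap (IwasawaAlgebra p) (IwasawaAlgebraO S)) ≠ ⊥ :=
    Ideal.comap_ne_bot_of_integral_mem ha0 (Ideal.mem_span_singleton_self a) hint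
  obtain ⟨r, hr, hr0⟩ := Submodule.exists_mem_ne_zero_of_ne_bot hne
  obtain ⟨c, hc⟩ := Ideal.mem_span_singleton'.mp (Ideal.mem_comap.mp hr)
  refine ⟨⟨r, mem_nonZeroDivisors_of_ne_zero hr0⟩, ?_⟩
  change r • x = 0
  change a • x = 0 at hax
  rw [← IsScalarTower.algebraMap_smul (IwasawaAlgebraO S) r x, ← hc, mul_smul, hax, smul_zero]

include halg in
/-- **Finitely generated over `Λ_𝒪` ⟹ finitely generated over `Λ`** (glue context), since `Λ_𝒪` is a finitely generated `Λ`-module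
(`SmallImageRttCharRoad.moduleFinite_iwasawaAlgebraO`). [folklore] -/
theorem moduleFinite_of_moduleFinite_iwasawaAlgebraO (M : Type v) [AddCommGroup M] [Module (IwasawaAlgebraO S) M]
    [Module (IwasawaAlgebra p) M] [IsScalarTower (IwasawaAlgebra p) (IwasawaAlgebraO S) M]
    [Module.Finite (IwasawaAlgebraO S) M] : Module.Finite (IwasawaAlgebra p) M := by
  haveI := SmallImageRttCharRoad.moduleFinite_iwasawaAlgebraO S halg
  exact Module.Finite.trans (IwasawaAlgebraO S) M

include halg in
/-- ★★ **`λ` is additive along products of characteristic ideals over `Λ_𝒪`.** In the glue's context (`[Algebra Λ Λ_𝒪]` with structure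
map `iwasawaToIwasawaO S`, scalar towers), for finitely generated torsion `Λ_𝒪 = 𝒪⟦T⟧`-modules `M`, `M'`, `N`:
`char_{Λ_𝒪}(M) · char_{Λ_𝒪}(M') = char_{Λ_𝒪}(N) ⟹ lambdaInvariant p M + lambdaInvariant p M' = lambdaInvariant p N`.
(`char(M × M') = char M · char M'` by multiplicativity on `0 → M → M × M' → M' → 0`; the (K)-socket
`SmallImageRttE2Num.lambdaInvariant_eq_of_span_C_mul_charIdeal_eq_of_algebraMap_eq` gives `λ(M × M') = λ(N)`; `λ(M × M') = λ M + λ M'` over `Λ`.)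
[cite: Washington1997, §13.2] [cite: BourbakiAC5to7, VII §4.5 Prop. 10] -/
theorem lambdaInvariant_add_eq_of_charIdeal_mul_eq_of_algebraMap_eq (M M' N : Type v) [AddCommGroup M] [AddCommGroup M']
    [AddCommGroup N] [Module (IwasawaAlgebraO S) M] [Module (IwasawaAlgebraO S) M'] [Module (IwasawaAlgebraO S) N]
    [Module.Finite (IwasawaAlgebraO S) M] [Module.Finite (IwasawaAlgebraO S) M'] [Module.Finite (IwasawaAlgebraO S) N]
    [Module (IwasawaAlgebra p) M] [Module (IwasawaAlgebra p) M'] [Module (IwasawaAlgebra p) N]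
    [IsScalarTower (IwasawaAlgebra p) (IwasawaAlgebraO S) M] [IsScalarTower (IwasawaAlgebra p) (IwasawaAlgebraO S) M']
    [IsScalarTower (IwasawaAlgebra p) (IwasawaAlgebraO S) N]
    (hM : Module.IsTorsion (IwasawaAlgebraO S) M) (hM' : Module.IsTorsion (IwasawaAlgebraO S) M')
    (hN : Module.IsTorsion (IwasawaAlgebraO S) N)
    (h : Module.charIdeal (IwasawaAlgebraO S) M * Module.charIdeal (IwasawaAlgebraO S) M' =
      Module.charIdeal (IwasawaAlgebraO S) N) :
    lambdaInvariant p M + lambdaInvariant p M' = lambdaInvariant p N := by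
  haveI : IsDiscreteValuationRing (padicCoeffIntegers S) := by
    rw [padicCoeffIntegers_eq_unitBall S]; exact LambdaLowerBoundO.isDiscreteValuationRing_unitBall p _
  have hMM' : Module.IsTorsion (IwasawaAlgebraO S) (M × M') := isTorsion_prod_of_isTorsion hM hM'
  have hprod : Module.charIdeal (IwasawaAlgebraO S) (M × M') =
      Module.charIdeal (IwasawaAlgebraO S) M * Module.charIdeal (IwasawaAlgebraO S) M' :=
    Module.charIdeal_eq_mul_of_exact hMM' (LinearMap.inl (IwasawaAlgebraO S) M M') (LinearMap.snd (IwasawaAlgebraO S) M M')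
      LinearMap.inl_injective LinearMap.snd_surjective Function.Exact.inl_snd
  have hl : lambdaInvariant p (M × M') = lambdaInvariant p N :=
    SmallImageRttE2Num.lambdaInvariant_eq_of_span_C_mul_charIdeal_eq_of_algebraMap_eq p S halg (M × M') N hMM' hN
      (c := 1) (d := 1) one_ne_zero one_ne_zero (by rw [hprod, h])
  -- additivity over `Λ`
  haveI : Module.Finite (IwasawaAlgebra p) (M × M') := moduleFinite_of_moduleFinite_iwasawaAlgebraO p S halg (M × M')
  have hΛt : Module.IsTorsion (IwasawaAlgebra p) (M × M') := isTorsion_of_isTorsion_iwasawaAlgebraO p S halg (M × M') hMM'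
  have hadd := Summit.BirchSwinnertonDyer.Rank1Residual.X2.DualRestrictionInvariants.lambdaInvariant_eq_add_of_surjective p
    (LinearMap.snd (IwasawaAlgebra p) M M') hΛt LinearMap.snd_surjective
  have hker : lambdaInvariant p (LinearMap.ker (LinearMap.snd (IwasawaAlgebra p) M M')) = lambdaInvariant p M :=
    lambdaInvariant_eq_of_linearEquiv ((LinearEquiv.ofEq _ _ (LinearMap.ker_snd _ _ _)).trans
      (LinearEquiv.ofInjective _ LinearMap.inl_injective).symm)
  rw [← hl, hadd, hker]


include halg in
/-- ★★ **`λ` is additive along products of characteristic ideals over `Λ_𝒪`, two factors on each side:**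
`char M · char M' = char N · char N' ⟹ lambdaInvariant p M + lambdaInvariant p M' = lambdaInvariant p N + lambdaInvariant p N'`
(finitely generated torsion `Λ_𝒪`-modules in the glue's context). [cite: Washington1997, §13.2] [cite: BourbakiAC5to7, VII §4.5 Prop. 10] -/
theorem lambdaInvariant_add_eq_add_of_charIdeal_mul_eq_mul_of_algebraMap_eq (M M' N N' : Type v) [AddCommGroup M] [AddCommGroup M']
    [AddCommGroup N] [AddCommGroup N'] [Module (IwasawaAlgebraO S) M] [Module (IwasawaAlgebraO S) M'] [Module (IwasawaAlgebraO S) N]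
    [Module (IwasawaAlgebraO S) N']
    [Module.Finite (IwasawaAlgebraO S) M] [Module.Finite (IwasawaAlgebraO S) M'] [Module.Finite (IwasawaAlgebraO S) N]
    [Module.Finite (IwasawaAlgebraO S) N']
    [Module (IwasawaAlgebra p) M] [Module (IwasawaAlgebra p) M'] [Module (IwasawaAlgebra p) N] [Module (IwasawaAlgebra p) N']
    [IsScalarTower (IwasawaAlgebra p) (IwasawaAlgebraO S) M] [IsScalarTower (IwasawaAlgebra p) (IwasawaAlgebraO S) M']
    [IsScalarTower (IwasawaAlgebra p) (IwasawaAlgebraO S) N] [IsScalarTower (IwasawaAlgebra p) (IwasawaAlgebraO S) N']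
    (hM : Module.IsTorsion (IwasawaAlgebraO S) M) (hM' : Module.IsTorsion (IwasawaAlgebraO S) M')
    (hN : Module.IsTorsion (IwasawaAlgebraO S) N) (hN' : Module.IsTorsion (IwasawaAlgebraO S) N')
    (h : Module.charIdeal (IwasawaAlgebraO S) M * Module.charIdeal (IwasawaAlgebraO S) M' =
      Module.charIdeal (IwasawaAlgebraO S) N * Module.charIdeal (IwasawaAlgebraO S) N') :
    lambdaInvariant p M + lambdaInvariant p M' = lambdaInvariant p N + lambdaInvariant p N' := by
  haveI : IsDiscreteValuationRing (padicCoeffIntegers S) := by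
    rw [padicCoeffIntegers_eq_unitBall S]; exact LambdaLowerBoundO.isDiscreteValuationRing_unitBall p _
  have hNN' : Module.IsTorsion (IwasawaAlgebraO S) (N × N') := isTorsion_prod_of_isTorsion hN hN'
  have hprod : Module.charIdeal (IwasawaAlgebraO S) (N × N') =
      Module.charIdeal (IwasawaAlgebraO S) N * Module.charIdeal (IwasawaAlgebraO S) N' :=
    Module.charIdeal_eq_mul_of_exact hNN' (LinearMap.inl (IwasawaAlgebraO S) N N') (LinearMap.snd (IwasawaAlgebraO S) N N')
      LinearMap.inl_injective LinearMap.snd_surjective Function.Exact.inl_snd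
  rw [lambdaInvariant_add_eq_of_charIdeal_mul_eq_of_algebraMap_eq p S halg M M' (N × N') hM hM' hNN' (by rw [hprod, h]),
    ← lambdaInvariant_add_eq_of_charIdeal_mul_eq_of_algebraMap_eq p S halg N N' (N × N') hN hN' hNN' hprod.symm]

end LambdaO


/-- **A module with one element has `λ = 0`** (`ℚ_p ⊗_{ℤ_p} 0 = 0`). [folklore] -/
theorem lambdaInvariant_eq_zero_of_subsingleton (p : ℕ) [Fact p.Prime] (X : Type v) [AddCommGroup X] [Module (IwasawaAlgebra p) X]
    [Subsingleton X] : lambdaInvariant p X = 0 := by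
  haveI : Subsingleton (RestrictScalars ℤ_[p] (IwasawaAlgebra p) X) := inferInstanceAs (Subsingleton X)
  haveI : Subsingleton (ℚ_[p] ⊗[ℤ_[p]] (RestrictScalars ℤ_[p] (IwasawaAlgebra p) X)) := by
    have h0 : ∀ t : ℚ_[p] ⊗[ℤ_[p]] (RestrictScalars ℤ_[p] (IwasawaAlgebra p) X), t = 0 := fun t ↦ by
      induction t using TensorProduct.induction_on with
      | zero => rfl
      | tmul q x => rw [Subsingleton.elim x 0, TensorProduct.tmul_zero]
      | add a b ha hb => rw [ha, hb, add_zero]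
    exact ⟨fun a b ↦ by rw [h0 a, h0 b]⟩
  exact Module.finrank_zero_of_subsingleton

section RoadD

variable (p : ℕ) [Fact p.Prime] (S : Set (PadicAlgCl p)) [FiniteDimensional ℚ_[p] (padicCoeffField S)]
  (b : padicCoeffIntegers S) (φ : PowerSeries (IwasawaAlgebraO S) →+* IwasawaAlgebraO S)
  (hφf : φ (C (X - C b)) = 0) (hC : ∀ a : padicCoeffIntegers S, φ (C (C a)) = C a) (hX : φ X = X)
  (hker : RingHom.ker φ = Ideal.span {C (X - C b)})

set_option maxHeartbeats 800000 in -- four pinned module binders: instance unification in the `λ_𝒪`-reading is slow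
include hφf hC hX hker in
/-- ★★ **Road D in EQUALITY form (four terms, no defect hypothesis).** `𝒪 = padicCoeffIntegers S` (`ℚ_p(S)/ℚ_p` finite), `Λ_𝒪 = 𝒪⟦T⟧`,
`R = 𝒪⟦T₂⟧⟦T₁⟧`, `f = C (X − C b)`, `φ : R →+* Λ_𝒪` with the inner-evaluation clauses, `ι = PowerSeries.map C`. For a `ZetaSkeleton` `D` over `R` with
`H1`, `H2` finitely generated, `D.Thm52Shape` and `f`-regularity `¬ char_R(H2) ≤ (f)`, and for ANY `Λ = ℤ_p⟦T⟧`-structures on the four specialised modules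
`(H1 ⧸ D.Z)/f`, `H2[f]`, `H2/f`, `(H1 ⧸ D.Z)[f]` pinned by `r • x = (ι (iwasawaToIwasawaO S r)) • x`:
`λ((H1 ⧸ D.Z)/f) + λ(H2[f]) = λ(H2/f) + λ((H1 ⧸ D.Z)[f])`. (p776030 `char((H¹⧸Z)/f)·char(H²[f]) = char(H²/f)·char((H¹⧸Z)[f])` read in `λ`
through `lambdaInvariant_add_eq_add_of_charIdeal_mul_eq_mul_of_algebraMap_eq`.) The one-sided p776332 drops the term `λ(H2[f])`; the E2-K junction
(BRIEF-E2 rev 3.2 §2) needs it. [cite: JohnsonLeungKings2011, Thm. 5.2, Cor. 5.3, Lemma 4.4] [cite: Washington1997, §13.2] [cite: BourbakiAC5to7, VII §4.5] -/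
theorem lambdaInvariant_quotSMulTop_add_torsionBy_eq_of_thm52Shape {Aidx H0 H1 H2 : Type v} [AddCommGroup H0]
    [Module (PowerSeries (IwasawaAlgebraO S)) H0] [AddCommGroup H1] [Module (PowerSeries (IwasawaAlgebraO S)) H1] [AddCommGroup H2]
    [Module (PowerSeries (IwasawaAlgebraO S)) H2] [Module.Finite (PowerSeries (IwasawaAlgebraO S)) H1]
    [Module.Finite (PowerSeries (IwasawaAlgebraO S)) H2]
    (D : ZetaSkeleton (PowerSeries (IwasawaAlgebraO S)) Aidx H0 H1 H2) (h52 : D.Thm52Shape)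
    (hreg : ¬ charIdeal (PowerSeries (IwasawaAlgebraO S)) H2 ≤ Ideal.span {(C (X - C b) : PowerSeries (IwasawaAlgebraO S))})
    [Module (IwasawaAlgebra p) (QuotSMulTop (C (X - C b) : PowerSeries (IwasawaAlgebraO S)) (H1 ⧸ D.Z))]
    [Module (IwasawaAlgebra p) (Submodule.torsionBy (PowerSeries (IwasawaAlgebraO S)) H2 (C (X - C b)))]
    [Module (IwasawaAlgebra p) (QuotSMulTop (C (X - C b) : PowerSeries (IwasawaAlgebraO S)) H2)]
    [Module (IwasawaAlgebra p) (Submodule.torsionBy (PowerSeries (IwasawaAlgebraO S)) (H1 ⧸ D.Z) (C (X - C b)))]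
    (hΛ1 : ∀ (r : IwasawaAlgebra p) (x : QuotSMulTop (C (X - C b) : PowerSeries (IwasawaAlgebraO S)) (H1 ⧸ D.Z)),
      r • x = (PowerSeries.map (PowerSeries.C : padicCoeffIntegers S →+* IwasawaAlgebraO S) (iwasawaToIwasawaO S r)) • x)
    (hΛ2 : ∀ (r : IwasawaAlgebra p) (x : Submodule.torsionBy (PowerSeries (IwasawaAlgebraO S)) H2 (C (X - C b))),
      r • x = (PowerSeries.map (PowerSeries.C : padicCoeffIntegers S →+* IwasawaAlgebraO S) (iwasawaToIwasawaO S r)) • x)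
    (hΛ3 : ∀ (r : IwasawaAlgebra p) (x : QuotSMulTop (C (X - C b) : PowerSeries (IwasawaAlgebraO S)) H2),
      r • x = (PowerSeries.map (PowerSeries.C : padicCoeffIntegers S →+* IwasawaAlgebraO S) (iwasawaToIwasawaO S r)) • x)
    (hΛ4 : ∀ (r : IwasawaAlgebra p) (x : Submodule.torsionBy (PowerSeries (IwasawaAlgebraO S)) (H1 ⧸ D.Z) (C (X - C b))),
      r • x = (PowerSeries.map (PowerSeries.C : padicCoeffIntegers S →+* IwasawaAlgebraO S) (iwasawaToIwasawaO S r)) • x) :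
    lambdaInvariant p (QuotSMulTop (C (X - C b) : PowerSeries (IwasawaAlgebraO S)) (H1 ⧸ D.Z)) +
        lambdaInvariant p (Submodule.torsionBy (PowerSeries (IwasawaAlgebraO S)) H2 (C (X - C b))) =
      lambdaInvariant p (QuotSMulTop (C (X - C b) : PowerSeries (IwasawaAlgebraO S)) H2) +
        lambdaInvariant p (Submodule.torsionBy (PowerSeries (IwasawaAlgebraO S)) (H1 ⧸ D.Z) (C (X - C b))) := by
  -- `𝒪` is a DVR, `R` factorial
  haveI : IsDiscreteValuationRing (padicCoeffIntegers S) := by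
    rw [padicCoeffIntegers_eq_unitBall S]; exact LambdaLowerBoundO.isDiscreteValuationRing_unitBall p _
  haveI : UniqueFactorizationMonoid (PowerSeries (IwasawaAlgebraO S)) :=
    Literature.NumberTheory.IwasawaTheory.uniqueFactorizationMonoid_powerSeries_powerSeries (padicCoeffIntegers S)
  -- the `Λ_𝒪`-structures by restriction along `ι`
  letI : Algebra (IwasawaAlgebraO S) (PowerSeries (IwasawaAlgebraO S)) :=
    (PowerSeries.map (PowerSeries.C : padicCoeffIntegers S →+* IwasawaAlgebraO S)).toAlgebra
  letI i1 : Module (IwasawaAlgebraO S) (H1 ⧸ D.Z) :=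
    Module.compHom (H1 ⧸ D.Z) (PowerSeries.map (PowerSeries.C : padicCoeffIntegers S →+* IwasawaAlgebraO S))
  letI i2 : Module (IwasawaAlgebraO S) H2 := Module.compHom H2 (PowerSeries.map (PowerSeries.C : padicCoeffIntegers S →+* IwasawaAlgebraO S))
  haveI : IsScalarTower (IwasawaAlgebraO S) (PowerSeries (IwasawaAlgebraO S)) (H1 ⧸ D.Z) := IsScalarTower.of_algebraMap_smul fun _ _ ↦ rfl
  haveI : IsScalarTower (IwasawaAlgebraO S) (PowerSeries (IwasawaAlgebraO S)) H2 := IsScalarTower.of_algebraMap_smul fun _ _ ↦ rfl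
  -- p776030: the specialised skeleton identity
  have key := charIdeal_specialisation_mul_eq_of_thm52Shape b φ hφf hC hX hker D h52 hreg
  -- finiteness / torsion over `Λ_𝒪` of the four specialised modules (p775349)
  obtain ⟨⟨-, -, htorsA, htorsB⟩, hchar⟩ := h52
  obtain ⟨tA, htA, htA0⟩ := Submodule.annihilator_top_inter_nonZeroDivisors htorsA
  obtain ⟨tB, htB, htB0⟩ := Submodule.annihilator_top_inter_nonZeroDivisors htorsB
  have htA' : ∀ m : H1 ⧸ D.Z, tA • m = 0 := fun m ↦ Submodule.mem_annihilator.mp htA m Submodule.mem_top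
  have htB' : ∀ m : H2, tB • m = 0 := fun m ↦ Submodule.mem_annihilator.mp htB m Submodule.mem_top
  obtain ⟨g, hg⟩ := (isPrincipal_charIdeal_of_ufm (R := PowerSeries (IwasawaAlgebraO S)) (M := H2)).principal
  have hgB : charIdeal (PowerSeries (IwasawaAlgebraO S)) H2 = Ideal.span {g} := hg
  have hgA : charIdeal (PowerSeries (IwasawaAlgebraO S)) (H1 ⧸ D.Z) = Ideal.span {g} := by
    rw [show charIdeal (PowerSeries (IwasawaAlgebraO S)) (H1 ⧸ D.Z) = charIdeal (PowerSeries (IwasawaAlgebraO S)) H2 from hchar, hgB]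
  have hg0 : φ g ≠ 0 := by
    intro h0
    apply hreg
    rw [hgB, Ideal.span_singleton_le_iff_mem, ← hker]
    exact h0
  obtain ⟨hfinQA, htorQA, hfinTA, htorTA⟩ := finite_isTorsion_quotSMulTop_torsionBy_of_innerEval b φ hφf hC hX hker (H1 ⧸ D.Z)
    (nonZeroDivisors.ne_zero htA0) htA' hgA hg0
  obtain ⟨hfinQB, htorQB, hfinTB, htorTB⟩ := finite_isTorsion_quotSMulTop_torsionBy_of_innerEval b φ hφf hC hX hker H2
    (nonZeroDivisors.ne_zero htB0) htB' hgB hg0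
  -- the glue's context: `Λ → Λ_𝒪` the structure map, towers from the pins
  letI : Algebra (IwasawaAlgebra p) (IwasawaAlgebraO S) := (iwasawaToIwasawaO S).toAlgebra
  haveI : IsScalarTower (IwasawaAlgebra p) (IwasawaAlgebraO S) (QuotSMulTop (C (X - C b) : PowerSeries (IwasawaAlgebraO S)) (H1 ⧸ D.Z)) :=
    IsScalarTower.of_algebraMap_smul fun r x ↦ by
      rw [hΛ1 r x]
      exact (IsScalarTower.algebraMap_smul (PowerSeries (IwasawaAlgebraO S)) (iwasawaToIwasawaO S r) x).symm
  haveI : IsScalarTower (IwasawaAlgebra p) (IwasawaAlgebraO S) (Submodule.torsionBy (PowerSeries (IwasawaAlgebraO S)) H2 (C (X - C b))) :=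
    IsScalarTower.of_algebraMap_smul fun r x ↦ by
      rw [hΛ2 r x]
      exact (IsScalarTower.algebraMap_smul (PowerSeries (IwasawaAlgebraO S)) (iwasawaToIwasawaO S r) x).symm
  haveI : IsScalarTower (IwasawaAlgebra p) (IwasawaAlgebraO S) (QuotSMulTop (C (X - C b) : PowerSeries (IwasawaAlgebraO S)) H2) :=
    IsScalarTower.of_algebraMap_smul fun r x ↦ by
      rw [hΛ3 r x]
      exact (IsScalarTower.algebraMap_smul (PowerSeries (IwasawaAlgebraO S)) (iwasawaToIwasawaO S r) x).symm
  haveI : IsScalarTower (IwasawaAlgebra p) (IwasawaAlgebraO S) (Submodule.torsionBy (PowerSeries (IwasawaAlgebraO S)) (H1 ⧸ D.Z) (C (X - C b))) :=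
    IsScalarTower.of_algebraMap_smul fun r x ↦ by
      rw [hΛ4 r x]
      exact (IsScalarTower.algebraMap_smul (PowerSeries (IwasawaAlgebraO S)) (iwasawaToIwasawaO S r) x).symm
  exact lambdaInvariant_add_eq_add_of_charIdeal_mul_eq_mul_of_algebraMap_eq p S (fun _ ↦ rfl) _ _ _ _ htorQA htorTB htorQB htorTA key

include hφf hC hX hker in
/-- ★★ **Road D in equality form with the defect term gone.** Under the hypotheses of `lambdaInvariant_quotSMulTop_add_torsionBy_eq_of_thm52Shape` and the
defect hypothesis `torsionBy R (H1 ⧸ D.Z) f = ⊥` (road D's `hdef`, from `H1[f] = 0` and the non-vanishing of the specialised zeta element — LEAD p777666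
`SmallImageRttCharRoad.torsionBy_quotient_Z_eq_bot_of_quotSMulTop_linearMap`): `λ((H1 ⧸ D.Z)/f) + λ(H2[f]) = λ(H2/f)`.
[cite: JohnsonLeungKings2011, Thm. 5.2, Cor. 5.3] [cite: Washington1997, §13.2] -/
theorem lambdaInvariant_quotSMulTop_add_torsionBy_eq_of_thm52Shape_of_torsionBy_eq_bot {Aidx H0 H1 H2 : Type v} [AddCommGroup H0]
    [Module (PowerSeries (IwasawaAlgebraO S)) H0] [AddCommGroup H1] [Module (PowerSeries (IwasawaAlgebraO S)) H1] [AddCommGroup H2]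
    [Module (PowerSeries (IwasawaAlgebraO S)) H2] [Module.Finite (PowerSeries (IwasawaAlgebraO S)) H1]
    [Module.Finite (PowerSeries (IwasawaAlgebraO S)) H2]
    (D : ZetaSkeleton (PowerSeries (IwasawaAlgebraO S)) Aidx H0 H1 H2) (h52 : D.Thm52Shape)
    (hreg : ¬ charIdeal (PowerSeries (IwasawaAlgebraO S)) H2 ≤ Ideal.span {(C (X - C b) : PowerSeries (IwasawaAlgebraO S))})
    (hdef : Submodule.torsionBy (PowerSeries (IwasawaAlgebraO S)) (H1 ⧸ D.Z) (C (X - C b)) = ⊥)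
    [Module (IwasawaAlgebra p) (QuotSMulTop (C (X - C b) : PowerSeries (IwasawaAlgebraO S)) (H1 ⧸ D.Z))]
    [Module (IwasawaAlgebra p) (Submodule.torsionBy (PowerSeries (IwasawaAlgebraO S)) H2 (C (X - C b)))]
    [Module (IwasawaAlgebra p) (QuotSMulTop (C (X - C b) : PowerSeries (IwasawaAlgebraO S)) H2)]
    (hΛ1 : ∀ (r : IwasawaAlgebra p) (x : QuotSMulTop (C (X - C b) : PowerSeries (IwasawaAlgebraO S)) (H1 ⧸ D.Z)),
      r • x = (PowerSeries.map (PowerSeries.C : padicCoeffIntegers S →+* IwasawaAlgebraO S) (iwasawaToIwasawaO S r)) • x)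
    (hΛ2 : ∀ (r : IwasawaAlgebra p) (x : Submodule.torsionBy (PowerSeries (IwasawaAlgebraO S)) H2 (C (X - C b))),
      r • x = (PowerSeries.map (PowerSeries.C : padicCoeffIntegers S →+* IwasawaAlgebraO S) (iwasawaToIwasawaO S r)) • x)
    (hΛ3 : ∀ (r : IwasawaAlgebra p) (x : QuotSMulTop (C (X - C b) : PowerSeries (IwasawaAlgebraO S)) H2),
      r • x = (PowerSeries.map (PowerSeries.C : padicCoeffIntegers S →+* IwasawaAlgebraO S) (iwasawaToIwasawaO S r)) • x) :
    lambdaInvariant p (QuotSMulTop (C (X - C b) : PowerSeries (IwasawaAlgebraO S)) (H1 ⧸ D.Z)) +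
        lambdaInvariant p (Submodule.torsionBy (PowerSeries (IwasawaAlgebraO S)) H2 (C (X - C b))) =
      lambdaInvariant p (QuotSMulTop (C (X - C b) : PowerSeries (IwasawaAlgebraO S)) H2) := by
  -- any pinned `Λ`-structure on the (trivial) defect module, e.g. the restriction along `ι ∘ iwasawaToIwasawaO S`
  letI iΛ : Module (IwasawaAlgebra p) (Submodule.torsionBy (PowerSeries (IwasawaAlgebraO S)) (H1 ⧸ D.Z) (C (X - C b))) :=
    Module.compHom _ ((PowerSeries.map (PowerSeries.C : padicCoeffIntegers S →+* IwasawaAlgebraO S)).comp (iwasawaToIwasawaO S))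
  have h := lambdaInvariant_quotSMulTop_add_torsionBy_eq_of_thm52Shape p S b φ hφf hC hX hker D h52 hreg hΛ1 hΛ2 hΛ3 (fun _ _ ↦ rfl)
  haveI : Subsingleton (Submodule.torsionBy (PowerSeries (IwasawaAlgebraO S)) (H1 ⧸ D.Z) (C (X - C b))) := by
    rw [hdef]; infer_instance
  rwa [lambdaInvariant_eq_zero_of_subsingleton p (Submodule.torsionBy (PowerSeries (IwasawaAlgebraO S)) (H1 ⧸ D.Z) (C (X - C b))),
    add_zero] at h

end RoadD

end Summit.BirchSwinnertonDyer.BirchSwinnertonDyer.Theorems.SmallImageRttD2LamSpec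

end
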